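import Literature.NumberTheory.Sieve.BombieriFriedlanderIwaniecDispersionS1
import HarnessLib

/-!
# Bombieri–Friedlander–Iwaniec 1986, §7 for Theorem 1: the main term `𝒳` versus `X`

Topic `Literature/NumberTheory/Sieve`.  Fifth file of the formalisation of the provable part of the
proof of Theorem 1 of E. Bombieri, J. B. Friedlander, H. Iwaniec, *Primes in arithmetic
progressions to large moduli*, Acta Math. 156 (1986), 203–251, after `…DispersionSmoothing` (§3),
`…DispersionS3` (§4), `…DispersionS2` (§5), `…DispersionS1` (§6).  This is §7 (pp. 222–223),
"Evaluation of `𝒳`": the main term `𝒳` (6.13) of `𝒮₁` is compared with the common main term `X`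
(4.1) of `𝒮₂` and `𝒮₃`, the difference being a sum of products of Barban–Davenport–Halberstam
deviations, to be bounded by Theorem 0 (a) (`BombieriFriedlanderIwaniecTheorem0a` of
`…DispersionProofs`, PROVED in the tree) in the assembly.  Everything here is PROVED; no named
facts are introduced.

## Contents

* `BFI.bdhDev N β d q l`, `BFI.bdhD N β d q` — the deviation and the sum of squared deviations over
  the reduced classes modulo `q` with the coprimality parameter `d`: EXACTLY the summand of
  Theorem 0 (a) in the form (7.2) (`BombieriFriedlanderIwaniecTheorem0a` bounds `∑_{q ≤ Q} bdhD`).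
* `BFI.clSum` (class sums), `BFI.sum_clSum`, `BFI.sum_bdhDev_eq_zero` (mean zero),
  **`BFI.sum_clSum_mul_clSum`** (the dispersion of the main term:
  `∑_{(l,q)=1} A₁(l)A₂(l) = c₁c₂/φ(q) + ∑ dev₁ dev₂`), `BFI.abs_sum_bdhDev_mul_le` (`≤ (D₁+D₂)/2`).
* `BFI.pairSum` and **`BFI.pairSum_eq_sum_clSum`** (p. 222: the pair sum of `𝒳` as
  `∑*_{l (q₀r)} (∑_{n≡l,(n,q₁')=1} β)(∑_{n≡l,(n,q₂')=1} β)`), **`BFI.mainX_term_eq`** (the `X`-term in the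
  same variables: the main terms agree EXACTLY, by `φ(q₁q₂r)φ(q₀r) = q₀φ(q₁r)φ(q₂r)`),
  `BFI.abs_pairSum_sub_mainX_term_le`.
* Trivial bounds: `BFI.card_primeFactors_le_log` (`ω(n) ≤ log₂ n`), `BFI.abs_sum_sum_ite_mul_le`,
  `BFI.abs_pairSum_le`, `BFI.pairSumN` and **`BFI.abs_pairSumN_le`** (pairs with a common factor,
  using (A₄) = `BFI.IsSifted`: `≤ log₂(2N)(2N/(z q₀r)+1)‖β‖²`), `BFI.calX_term_eq`, `BFI.xErr`.
* **`BFI.abs_calX_sub_mainX_le`** — `|𝒳 − X| ≤ ∑_{r∼R}∑_{q₁,q₂∼Q} xErr` with `xErr` = (for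
  `q₀ ≤ Q₀`) `|γγ|/L·(D(q₁';q₀r)+D(q₂';q₀r))/2 + |γγ|/L·log₂(2N)(2N/(zq₀r)+1)‖β‖²`, (for `q₀ > Q₀`)
  `|γγ|(∑|β|)²/(Lφ(q₀r))`.

## Faithfulness

BFI (7.1)–(7.5) with the error terms explicit and un-averaged; the truncation `q₀ ≤ Q₀` is the one
of `BFI.Main` (§6 file).  BFI remove `μ²(n₁n₂)` and `(n₁,n₂) = 1` "by the arguments for (6.4)"
(Lemma 3); here `(n₁,n₂) = 1` is removed by the trivial count under (A₄) (`abs_pairSumN_le`), which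
suffices because it happens after Poisson summation (the saving `1/L` is already present).

## References

* E. Bombieri, J. B. Friedlander, H. Iwaniec, Acta Math. 156 (1986), 203–251, §7 pp. 222–223,
  (7.1)–(7.5); §2 Theorem 0 (a) p. 211. [BombieriFriedlanderIwaniecActa1986]
-/

noncomputable section

open Finset Real
open scoped ArithmeticFunction.sigma

namespace Literature.NumberTheory.Sieve

namespace BFI

/-! ### The Barban–Davenport–Halberstam deviations (the summand of (7.2)) -/

/-- The deviation of `β` in the class `l (mod q)` with the coprimality condition `(n, d) = 1`
(the quantity squared in BFI (7.2), p. 222, and in Theorem 0 (a)):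
`∑_{n∼N, n≡l (q), (n,d)=1} β_n − φ(q)⁻¹ ∑_{n∼N, (n,dq)=1} β_n`.
[cite: BombieriFriedlanderIwaniecActa1986, §7 (7.2) p. 222] -/
def bdhDev (N : ℝ) (β : ℕ → ℝ) (d q l : ℕ) : ℝ :=
  (∑ n ∈ dyadic N, if (n : ZMod q) = (l : ZMod q) ∧ n.Coprime d then β n else 0) -
    (∑ n ∈ dyadic N, if n.Coprime (d * q) then β n else 0) / (Nat.totient q : ℝ)

/-- The sum of the squared deviations over the reduced classes modulo `q` (the inner sum of
(7.2)). [cite: BombieriFriedlanderIwaniecActa1986, §7 (7.2) p. 222] -/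
def bdhD (N : ℝ) (β : ℕ → ℝ) (d q : ℕ) : ℝ :=
  ∑ l ∈ (Finset.range q).filter (fun l => l.Coprime q), bdhDev N β d q l ^ 2

/-- `D ≥ 0`. [folklore] -/
theorem bdhD_nonneg (N : ℝ) (β : ℕ → ℝ) (d q : ℕ) : 0 ≤ bdhD N β d q :=
  Finset.sum_nonneg fun _ _ => sq_nonneg _

/-- The class sum `A(l) = ∑_{n∼N, n≡l (q), (n,d)=1} β_n`. [folklore] -/
def clSum (N : ℝ) (β : ℕ → ℝ) (d q l : ℕ) : ℝ :=
  ∑ n ∈ dyadic N, if (n : ZMod q) = (l : ZMod q) ∧ n.Coprime d then β n else 0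

/-- `A(l) = (∑_{(n,dq)=1} β)/φ(q) + dev(l)`. [folklore] -/
theorem clSum_eq_mean_add_bdhDev (N : ℝ) (β : ℕ → ℝ) (d q l : ℕ) :
    clSum N β d q l = cSum N β (d * q) / (Nat.totient q : ℝ) + bdhDev N β d q l := by
  unfold clSum bdhDev cSum
  ring

/-- Summing the class sums over the reduced classes recovers the coprimality sum:
`∑_{l (mod q), (l,q)=1} A(l) = ∑_{(n, dq)=1} β_n` (`q ≥ 1`). [folklore] -/
theorem sum_clSum (N : ℝ) (β : ℕ → ℝ) (d : ℕ) {q : ℕ} (hq : 0 < q) :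
    ∑ l ∈ (Finset.range q).filter (fun l => l.Coprime q), clSum N β d q l = cSum N β (d * q) := by
  haveI : NeZero q := ⟨hq.ne'⟩
  unfold clSum cSum
  rw [Finset.sum_comm]
  refine Finset.sum_congr rfl fun n _ => ?_
  by_cases hn : n.Coprime (d * q)
  · rw [if_pos hn]
    have hnq : n.Coprime q := Nat.Coprime.coprime_dvd_right (dvd_mul_left q d) hn
    have hnd : n.Coprime d := Nat.Coprime.coprime_dvd_right (dvd_mul_right d q) hn
    rw [Finset.sum_eq_single_of_mem (n % q)]
    · rw [if_pos ⟨by rw [ZMod.natCast_mod], hnd⟩]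
    · rw [Finset.mem_filter, Finset.mem_range]
      refine ⟨Nat.mod_lt _ hq, ?_⟩
      have : Nat.gcd (n % q) q = Nat.gcd n q := by
        rw [← Nat.gcd_rec, Nat.gcd_comm]
      rw [Nat.Coprime, this]
      exact hnq
    · intro l hl hne
      rw [if_neg]
      rintro ⟨h, _⟩
      apply hne
      rw [Finset.mem_filter, Finset.mem_range] at hl
      have := (ZMod.natCast_eq_natCast_iff' n l q).1 h
      rw [Nat.mod_eq_of_lt hl.1] at this
      exact this.symm
  · rw [if_neg hn]
    refine Finset.sum_eq_zero fun l hl => ?_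
    rw [if_neg]
    rintro ⟨h, hnd⟩
    apply hn
    rw [Finset.mem_filter, Finset.mem_range] at hl
    have hlq : Nat.gcd (n % q) q = 1 := by
      have := (ZMod.natCast_eq_natCast_iff' n l q).1 h
      rw [Nat.mod_eq_of_lt hl.1] at this
      rw [this]
      exact hl.2
    have hnq : n.Coprime q := by
      rw [Nat.Coprime, Nat.gcd_comm, Nat.gcd_rec]
      exact hlq
    exact Nat.Coprime.mul_right hnd hnq

/-- The deviations have mean zero over the reduced classes: `∑_{(l,q)=1} bdhDev(l) = 0` (`q ≥ 1`).
[folklore] -/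
theorem sum_bdhDev_eq_zero (N : ℝ) (β : ℕ → ℝ) (d : ℕ) {q : ℕ} (hq : 0 < q) :
    ∑ l ∈ (Finset.range q).filter (fun l => l.Coprime q), bdhDev N β d q l = 0 := by
  have h := sum_clSum N β d hq
  simp only [clSum_eq_mean_add_bdhDev, Finset.sum_add_distrib, Finset.sum_const, nsmul_eq_mul] at h
  have hcard : (((Finset.range q).filter (fun l => l.Coprime q)).card : ℝ) = Nat.totient q := by
    rw [Nat.totient_eq_card_coprime]
    congr 1
    refine congrArg Finset.card (Finset.filter_congr fun l _ => ?_)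
    exact Nat.coprime_comm
  rw [hcard] at h
  have hφ : (0 : ℝ) < Nat.totient q := by exact_mod_cast Nat.totient_pos.2 hq
  field_simp at h
  linarith

/-- **The dispersion of the main term** (BFI §7 p. 222, the display before (7.2)): for `q ≥ 1`
and any `d₁, d₂`,
`∑_{(l,q)=1} A₁(l) A₂(l) = (∑_{(n,d₁q)=1} β)(∑_{(n,d₂q)=1} β)/φ(q) + ∑_{(l,q)=1} dev₁(l) dev₂(l)`.
[cite: BombieriFriedlanderIwaniecActa1986, §7 p. 222] -/
theorem sum_clSum_mul_clSum (N : ℝ) (β : ℕ → ℝ) (d₁ d₂ : ℕ) {q : ℕ} (hq : 0 < q) :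
    ∑ l ∈ (Finset.range q).filter (fun l => l.Coprime q), clSum N β d₁ q l * clSum N β d₂ q l =
      cSum N β (d₁ * q) * cSum N β (d₂ * q) / (Nat.totient q : ℝ) +
        ∑ l ∈ (Finset.range q).filter (fun l => l.Coprime q), bdhDev N β d₁ q l * bdhDev N β d₂ q l := by
  have h1 := sum_bdhDev_eq_zero N β d₁ hq
  have h2 := sum_bdhDev_eq_zero N β d₂ hq
  have hcard : (((Finset.range q).filter (fun l => l.Coprime q)).card : ℝ) = Nat.totient q := by
    rw [Nat.totient_eq_card_coprime]
    congr 1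
    refine congrArg Finset.card (Finset.filter_congr fun l _ => ?_)
    exact Nat.coprime_comm
  have hφ : (0 : ℝ) < Nat.totient q := by exact_mod_cast Nat.totient_pos.2 hq
  simp only [clSum_eq_mean_add_bdhDev]
  have e : ∀ l : ℕ, (cSum N β (d₁ * q) / (Nat.totient q : ℝ) + bdhDev N β d₁ q l) *
      (cSum N β (d₂ * q) / (Nat.totient q : ℝ) + bdhDev N β d₂ q l) =
      cSum N β (d₁ * q) / (Nat.totient q : ℝ) * (cSum N β (d₂ * q) / (Nat.totient q : ℝ)) +
        (cSum N β (d₁ * q) / (Nat.totient q : ℝ)) * bdhDev N β d₂ q l +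
        (cSum N β (d₂ * q) / (Nat.totient q : ℝ)) * bdhDev N β d₁ q l +
        bdhDev N β d₁ q l * bdhDev N β d₂ q l := fun l => by ring
  simp only [e, Finset.sum_add_distrib, ← Finset.mul_sum, h1, h2, mul_zero, add_zero,
    Finset.sum_const, nsmul_eq_mul, hcard]
  field_simp

/-- Cauchy/AM–GM for the cross term: `|∑ dev₁ dev₂| ≤ (D₁ + D₂)/2`. [folklore] -/
theorem abs_sum_bdhDev_mul_le (N : ℝ) (β : ℕ → ℝ) (d₁ d₂ q : ℕ) :
    |∑ l ∈ (Finset.range q).filter (fun l => l.Coprime q), bdhDev N β d₁ q l * bdhDev N β d₂ q l| ≤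
      (bdhD N β d₁ q + bdhD N β d₂ q) / 2 := by
  unfold bdhD
  rw [← Finset.sum_add_distrib, Finset.sum_div]
  refine (Finset.abs_sum_le_sum_abs _ _).trans (Finset.sum_le_sum fun l _ => ?_)
  rw [abs_mul]
  nlinarith [sq_nonneg (|bdhDev N β d₁ q l| - |bdhDev N β d₂ q l|), sq_abs (bdhDev N β d₁ q l),
    sq_abs (bdhDev N β d₂ q l)]


/-! ### The pair sums of `𝒳` as class sums modulo `q₀ r` -/

/-- `qᵢ r = qᵢ' · (q₀ r)`. [folklore] -/
theorem mul_eq_div_mul_gmod_left (r q₁ q₂ : ℕ) : q₁ * r = (q₁ / Nat.gcd q₁ q₂) * gmod r q₁ q₂ := by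
  unfold gmod
  rw [← mul_assoc, Nat.div_mul_cancel (Nat.gcd_dvd_left q₁ q₂)]

/-- `q₂ r = q₂' · (q₀ r)`. [folklore] -/
theorem mul_eq_div_mul_gmod_right (r q₁ q₂ : ℕ) : q₂ * r = (q₂ / Nat.gcd q₁ q₂) * gmod r q₁ q₂ := by
  unfold gmod
  rw [← mul_assoc, Nat.div_mul_cancel (Nat.gcd_dvd_right q₁ q₂)]

/-- The pair sum of `𝒳` at `(r, q₁, q₂)` (all pairs `n₁, n₂` for which (6.1) is solvable):
`∑_{n₁,n₂ ∼ N, solvable} β_{n₁} β_{n₂}`. [folklore] -/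
def pairSum (a : ℤ) (r q₁ q₂ : ℕ) (N : ℝ) (β : ℕ → ℝ) : ℝ :=
  ∑ n₁ ∈ dyadic N, ∑ n₂ ∈ dyadic N,
    if IsCoprime ((q₁ * q₂ * r : ℕ) : ℤ) a ∧ n₁.Coprime (q₁ * r) ∧ n₂.Coprime (q₂ * r) ∧
      (n₁ : ZMod (gmod r q₁ q₂)) = (n₂ : ZMod (gmod r q₁ q₂)) then β n₁ * β n₂ else 0

/-- **The pair sum as a sum over reduced classes** (BFI §7 p. 222: "`𝒳 = ∑ … ∑*_{l (q₀r)}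
(∑_{n≡l (q₀r), (n,q₁)=1} β_n)(∑_{n≡l (q₀r), (n,q₂)=1} β_n)`"): for `r, q₁ ≥ 1`,
`pairSum = [(q₁q₂r, a) = 1] ∑_{(l, q₀r)=1} A(q₁'; l) A(q₂'; l)` with `A(d; l) = clSum N β d (q₀r) l`.
[cite: BombieriFriedlanderIwaniecActa1986, §7 p. 222] -/
theorem pairSum_eq_sum_clSum (a : ℤ) {r q₁ q₂ : ℕ} (hr : 0 < r) (hq₁ : 0 < q₁) (N : ℝ)
    (β : ℕ → ℝ) :
    pairSum a r q₁ q₂ N β =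
      if IsCoprime ((q₁ * q₂ * r : ℕ) : ℤ) a then
        ∑ l ∈ (Finset.range (gmod r q₁ q₂)).filter (fun l => l.Coprime (gmod r q₁ q₂)),
          clSum N β (q₁ / Nat.gcd q₁ q₂) (gmod r q₁ q₂) l *
            clSum N β (q₂ / Nat.gcd q₁ q₂) (gmod r q₁ q₂) l
      else 0 := by
  set G := gmod r q₁ q₂ with hG
  have hGpos : 0 < G := gmod_pos hr hq₁
  haveI : NeZero G := ⟨hGpos.ne'⟩
  have e1 := mul_eq_div_mul_gmod_left r q₁ q₂
  have e2 := mul_eq_div_mul_gmod_right r q₁ q₂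
  rw [← hG] at e1 e2
  unfold pairSum
  split_ifs with hka
  · -- expand the right-hand side
    unfold clSum
    simp only [Finset.sum_mul_sum]
    symm
    rw [Finset.sum_comm]
    refine Finset.sum_congr rfl fun n₁ _ => ?_
    rw [Finset.sum_comm]
    refine Finset.sum_congr rfl fun n₂ _ => ?_
    -- pointwise: `[conds] β₁β₂ = ∑_l [n₁≡l ∧ cop][n₂≡l ∧ cop] β₁ β₂`
    have key : ∀ l ∈ (Finset.range G).filter (fun l => l.Coprime G),
        (if (n₁ : ZMod G) = (l : ZMod G) ∧ n₁.Coprime (q₁ / Nat.gcd q₁ q₂) then β n₁ else 0) *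
          (if (n₂ : ZMod G) = (l : ZMod G) ∧ n₂.Coprime (q₂ / Nat.gcd q₁ q₂) then β n₂ else 0) =
        if (n₁ : ZMod G) = (l : ZMod G) ∧ (n₁.Coprime (q₁ * r) ∧ n₂.Coprime (q₂ * r) ∧
          (n₁ : ZMod G) = (n₂ : ZMod G)) then β n₁ * β n₂ else 0 := by
      intro l hl
      rw [Finset.mem_filter, Finset.mem_range] at hl
      have hlu : ∀ n : ℕ, (n : ZMod G) = (l : ZMod G) → n.Coprime G := by
        intro n hn
        have := (ZMod.natCast_eq_natCast_iff' n l G).1 hn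
        rw [Nat.mod_eq_of_lt hl.1] at this
        rw [Nat.Coprime, Nat.gcd_comm, Nat.gcd_rec, this]
        exact hl.2
      by_cases h1 : (n₁ : ZMod G) = (l : ZMod G) ∧ n₁.Coprime (q₁ / Nat.gcd q₁ q₂)
      · by_cases h2 : (n₂ : ZMod G) = (l : ZMod G) ∧ n₂.Coprime (q₂ / Nat.gcd q₁ q₂)
        · rw [if_pos h1, if_pos h2, if_pos]
          refine ⟨h1.1, ?_, ?_, h1.1.trans h2.1.symm⟩
          · rw [e1]; exact Nat.Coprime.mul_right h1.2 (hlu n₁ h1.1)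
          · rw [e2]; exact Nat.Coprime.mul_right h2.2 (hlu n₂ h2.1)
        · rw [if_pos h1, if_neg h2, mul_zero, if_neg]
          rintro ⟨hn₁l, _, hn₂, hn₁₂⟩
          apply h2
          refine ⟨hn₁₂.symm.trans hn₁l, ?_⟩
          rw [e2] at hn₂
          exact Nat.Coprime.coprime_dvd_right (dvd_mul_right _ _) hn₂
      · rw [if_neg h1, zero_mul, if_neg]
        rintro ⟨hn₁l, hn₁, _, _⟩
        apply h1
        refine ⟨hn₁l, ?_⟩
        rw [e1] at hn₁
        exact Nat.Coprime.coprime_dvd_right (dvd_mul_right _ _) hn₁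
    rw [Finset.sum_congr rfl key]
    -- now the `l`-sum has at most one term
    by_cases hc : n₁.Coprime (q₁ * r) ∧ n₂.Coprime (q₂ * r) ∧ (n₁ : ZMod G) = (n₂ : ZMod G)
    · rw [if_pos ⟨hka, hc⟩]
      have hn₁G : n₁.Coprime G := by
        have := hc.1; rw [e1] at this
        exact Nat.Coprime.coprime_dvd_right (dvd_mul_left _ _) this
      rw [Finset.sum_eq_single_of_mem (n₁ % G)]
      · rw [if_pos ⟨by rw [ZMod.natCast_mod], hc⟩]
      · rw [Finset.mem_filter, Finset.mem_range]
        refine ⟨Nat.mod_lt _ hGpos, ?_⟩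
        rw [Nat.Coprime, ← Nat.gcd_rec, Nat.gcd_comm]
        exact hn₁G
      · intro l hl hne
        rw [if_neg]
        rintro ⟨h, _⟩
        apply hne
        rw [Finset.mem_filter, Finset.mem_range] at hl
        have := (ZMod.natCast_eq_natCast_iff' n₁ l G).1 h
        rw [Nat.mod_eq_of_lt hl.1] at this
        exact this.symm
    · rw [if_neg (fun h => hc h.2)]
      refine Finset.sum_eq_zero fun l _ => ?_
      rw [if_neg (fun h => hc h.2)]
  · refine Finset.sum_eq_zero fun n₁ _ => Finset.sum_eq_zero fun n₂ _ => ?_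
    rw [if_neg (fun h => hka h.1)]

/-- The `X`-term at `(r, q₁, q₂)` in the same variables:
`[(q₁q₂r,a)=1] γγ (c₁/φ₁)(c₂/φ₂) φ(k)/k = [(q₁q₂r,a)=1] γγ c(q₁'·q₀r) c(q₂'·q₀r)/(L φ(q₀r))`
(`L = [q₁,q₂]r`; the identity `φ(q₁q₂r) φ(q₀r) = q₀ φ(q₁r) φ(q₂r)`).
[cite: BombieriFriedlanderIwaniecActa1986, §7 (7.4)–(7.5) p. 223] -/
theorem mainX_term_eq (a : ℤ) {r q₁ q₂ : ℕ} (hr : 0 < r) (hq₁ : 0 < q₁) (hq₂ : 0 < q₂) (N : ℝ)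
    (β γ : ℕ → ℝ) :
    (if IsCoprime ((q₁ * q₂ * r : ℕ) : ℤ) a then
        γ q₁ * γ q₂ * (cSum N β (q₁ * r) / (Nat.totient (q₁ * r) : ℝ)) *
          (cSum N β (q₂ * r) / (Nat.totient (q₂ * r) : ℝ)) *
          ((Nat.totient (q₁ * q₂ * r) : ℝ) / ((q₁ * q₂ * r : ℕ) : ℝ))
      else 0) =
      if IsCoprime ((q₁ * q₂ * r : ℕ) : ℤ) a then
        γ q₁ * γ q₂ * (cSum N β ((q₁ / Nat.gcd q₁ q₂) * gmod r q₁ q₂) *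
          cSum N β ((q₂ / Nat.gcd q₁ q₂) * gmod r q₁ q₂)) /
          ((lmod r q₁ q₂ : ℝ) * (Nat.totient (gmod r q₁ q₂) : ℝ))
      else 0 := by
  split_ifs with hka
  · rw [← mul_eq_div_mul_gmod_left, ← mul_eq_div_mul_gmod_right]
    have hid := totient_mul_mul_totient_gcd_mul (q₁ := q₁) (q₂ := q₂) hr
    have hLg := lmod_mul_gcd r q₁ q₂
    have hφ₁ : (0 : ℝ) < (Nat.totient (q₁ * r) : ℝ) := by
      exact_mod_cast Nat.totient_pos.2 (Nat.mul_pos hq₁ hr)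
    have hφ₂ : (0 : ℝ) < (Nat.totient (q₂ * r) : ℝ) := by
      exact_mod_cast Nat.totient_pos.2 (Nat.mul_pos hq₂ hr)
    have hφG : (0 : ℝ) < (Nat.totient (gmod r q₁ q₂) : ℝ) := by
      exact_mod_cast Nat.totient_pos.2 (gmod_pos hr hq₁)
    have hL : (0 : ℝ) < (lmod r q₁ q₂ : ℝ) := by exact_mod_cast lmod_pos hr hq₁ hq₂
    have hg : (0 : ℝ) < (Nat.gcd q₁ q₂ : ℝ) := by exact_mod_cast Nat.gcd_pos_of_pos_left _ hq₁
    have hk : ((q₁ * q₂ * r : ℕ) : ℝ) = (lmod r q₁ q₂ : ℝ) * (Nat.gcd q₁ q₂ : ℝ) := by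
      rw [← hLg]; push_cast; ring
    have hidR : (Nat.totient (q₁ * q₂ * r) : ℝ) * (Nat.totient (gmod r q₁ q₂) : ℝ) =
        (Nat.gcd q₁ q₂ : ℝ) * (Nat.totient (q₁ * r) : ℝ) * (Nat.totient (q₂ * r) : ℝ) := by
      unfold gmod
      exact_mod_cast hid
    rw [hk]
    field_simp
    linear_combination (cSum N β (q₁ * r) * cSum N β (q₂ * r) * γ q₁ * γ q₂) * hidR
  · rfl

/-- **`𝒳` versus `X` at one index** (BFI (7.4)–(7.5)): for `r, q₁, q₂ ≥ 1`,
`γγ · pairSum/L − Xterm = [(q₁q₂r,a)=1] (γγ/L) ∑_{(l,q₀r)=1} dev(q₁'; l) dev(q₂'; l)`, hence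
`|γγ pairSum/L − Xterm| ≤ |γ_{q₁}γ_{q₂}|/L · (D(q₁'; q₀r) + D(q₂'; q₀r))/2` (`D = BFI.bdhD`).
[cite: BombieriFriedlanderIwaniecActa1986, §7 (7.2)–(7.5) pp. 222–223] -/
theorem abs_pairSum_sub_mainX_term_le (a : ℤ) {r q₁ q₂ : ℕ} (hr : 0 < r) (hq₁ : 0 < q₁)
    (hq₂ : 0 < q₂) (N : ℝ) (β γ : ℕ → ℝ) :
    |γ q₁ * γ q₂ * pairSum a r q₁ q₂ N β / (lmod r q₁ q₂ : ℝ) -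
        (if IsCoprime ((q₁ * q₂ * r : ℕ) : ℤ) a then
          γ q₁ * γ q₂ * (cSum N β (q₁ * r) / (Nat.totient (q₁ * r) : ℝ)) *
            (cSum N β (q₂ * r) / (Nat.totient (q₂ * r) : ℝ)) *
            ((Nat.totient (q₁ * q₂ * r) : ℝ) / ((q₁ * q₂ * r : ℕ) : ℝ))
        else 0)| ≤
      |γ q₁| * |γ q₂| / (lmod r q₁ q₂ : ℝ) *
        ((bdhD N β (q₁ / Nat.gcd q₁ q₂) (gmod r q₁ q₂) +
          bdhD N β (q₂ / Nat.gcd q₁ q₂) (gmod r q₁ q₂)) / 2) := by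
  rw [mainX_term_eq a hr hq₁ hq₂, pairSum_eq_sum_clSum a hr hq₁]
  have hL : (0 : ℝ) < (lmod r q₁ q₂ : ℝ) := by exact_mod_cast lmod_pos hr hq₁ hq₂
  have hGpos : 0 < gmod r q₁ q₂ := gmod_pos hr hq₁
  split_ifs with hka
  · rw [sum_clSum_mul_clSum N β _ _ hGpos]
    have hφG : (0 : ℝ) < (Nat.totient (gmod r q₁ q₂) : ℝ) := by
      exact_mod_cast Nat.totient_pos.2 hGpos
    have e : γ q₁ * γ q₂ * (cSum N β ((q₁ / Nat.gcd q₁ q₂) * gmod r q₁ q₂) *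
        cSum N β ((q₂ / Nat.gcd q₁ q₂) * gmod r q₁ q₂) / (Nat.totient (gmod r q₁ q₂) : ℝ) +
        ∑ l ∈ (Finset.range (gmod r q₁ q₂)).filter (fun l => l.Coprime (gmod r q₁ q₂)),
          bdhDev N β (q₁ / Nat.gcd q₁ q₂) (gmod r q₁ q₂) l *
            bdhDev N β (q₂ / Nat.gcd q₁ q₂) (gmod r q₁ q₂) l) / (lmod r q₁ q₂ : ℝ) -
        γ q₁ * γ q₂ * (cSum N β ((q₁ / Nat.gcd q₁ q₂) * gmod r q₁ q₂) *
          cSum N β ((q₂ / Nat.gcd q₁ q₂) * gmod r q₁ q₂)) /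
          ((lmod r q₁ q₂ : ℝ) * (Nat.totient (gmod r q₁ q₂) : ℝ)) =
        (γ q₁ * γ q₂ / (lmod r q₁ q₂ : ℝ)) *
          ∑ l ∈ (Finset.range (gmod r q₁ q₂)).filter (fun l => l.Coprime (gmod r q₁ q₂)),
            bdhDev N β (q₁ / Nat.gcd q₁ q₂) (gmod r q₁ q₂) l *
              bdhDev N β (q₂ / Nat.gcd q₁ q₂) (gmod r q₁ q₂) l := by
      field_simp
      ring
    rw [e, abs_mul, abs_div, abs_mul, abs_of_pos hL]
    exact mul_le_mul_of_nonneg_left (abs_sum_bdhDev_mul_le N β _ _ _) (by positivity)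
  · simp only [mul_zero, zero_div, sub_zero, abs_zero]
    have := bdhD_nonneg N β (q₁ / Nat.gcd q₁ q₂) (gmod r q₁ q₂)
    have := bdhD_nonneg N β (q₂ / Nat.gcd q₁ q₂) (gmod r q₁ q₂)
    positivity


/-! ### Trivial bounds for the pair sums -/

/-- `ω(n) ≤ log₂ n` (same statement as `BombieriSieve.card_primeFactors_le_log` of
`…BombieriAsymptoticSieveSigma0Comb`, re-proved here in five lines to avoid importing the
asymptotic-sieve files into the dispersion cluster). [folklore] -/
theorem card_primeFactors_le_log (n : ℕ) : n.primeFactors.card ≤ Nat.log 2 n := by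
  rcases Nat.eq_zero_or_pos n with rfl | hn
  · simp
  refine Nat.le_log_of_pow_le one_lt_two ?_
  calc 2 ^ n.primeFactors.card ≤ ∏ p ∈ n.primeFactors, p :=
        Finset.pow_card_le_prod _ _ _ fun p hp => (Nat.prime_of_mem_primeFactors hp).two_le
    _ ≤ n := Nat.le_of_dvd hn (Nat.prod_primeFactors_dvd n)

/-- A symmetric trivial bound for a weighted pair count: if every row and every column of the
0/1-pattern `P` carrying a nonzero weight has at most `C` entries, then
`|∑_{n₁,n₂} [P] β_{n₁}β_{n₂}| ≤ C ‖β‖²`. [folklore] -/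
theorem abs_sum_sum_ite_mul_le {N : ℝ} (β : ℕ → ℝ) (P : ℕ → ℕ → Prop) [∀ n₁ n₂, Decidable (P n₁ n₂)]
    {C : ℝ}
    (hrow : ∀ n₁ ∈ dyadic N, β n₁ ≠ 0 → (#((dyadic N).filter (fun n₂ => P n₁ n₂)) : ℝ) ≤ C)
    (hcol : ∀ n₂ ∈ dyadic N, β n₂ ≠ 0 → (#((dyadic N).filter (fun n₁ => P n₁ n₂)) : ℝ) ≤ C) :
    |∑ n₁ ∈ dyadic N, ∑ n₂ ∈ dyadic N, (if P n₁ n₂ then β n₁ * β n₂ else 0)| ≤ C * l2Sq N β := by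
  have key : ∀ n₁ n₂ : ℕ, |(if P n₁ n₂ then β n₁ * β n₂ else 0)| ≤
      (if P n₁ n₂ then β n₁ ^ 2 else 0) / 2 + (if P n₁ n₂ then β n₂ ^ 2 else 0) / 2 := by
    intro n₁ n₂
    split_ifs
    · rw [abs_mul]
      nlinarith [sq_nonneg (|β n₁| - |β n₂|), sq_abs (β n₁), sq_abs (β n₂)]
    · simp
  refine (Finset.abs_sum_le_sum_abs _ _).trans ?_
  refine (Finset.sum_le_sum fun n₁ _ => Finset.abs_sum_le_sum_abs _ _).trans ?_
  refine (Finset.sum_le_sum fun n₁ _ => Finset.sum_le_sum fun n₂ _ => key n₁ n₂).trans ?_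
  rw [Finset.sum_comm]
  simp only [Finset.sum_add_distrib]
  rw [Finset.sum_comm]
  -- rows
  have h1 : ∑ n₁ ∈ dyadic N, ∑ n₂ ∈ dyadic N, (if P n₁ n₂ then β n₁ ^ 2 else 0) / 2 ≤
      C * l2Sq N β / 2 := by
    unfold l2Sq
    rw [Finset.mul_sum, Finset.sum_div]
    refine Finset.sum_le_sum fun n₁ hn₁ => ?_
    rw [← Finset.sum_div, ← Finset.sum_filter, Finset.sum_const, nsmul_eq_mul]
    by_cases hb : β n₁ = 0
    · simp [hb]
    · exact div_le_div_of_nonneg_right (by nlinarith [hrow n₁ hn₁ hb, sq_nonneg (β n₁)]) (by norm_num)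
  have h2 : ∑ n₂ ∈ dyadic N, ∑ n₁ ∈ dyadic N, (if P n₁ n₂ then β n₂ ^ 2 else 0) / 2 ≤
      C * l2Sq N β / 2 := by
    unfold l2Sq
    rw [Finset.mul_sum, Finset.sum_div]
    refine Finset.sum_le_sum fun n₂ hn₂ => ?_
    rw [← Finset.sum_div, ← Finset.sum_filter, Finset.sum_const, nsmul_eq_mul]
    by_cases hb : β n₂ = 0
    · simp [hb]
    · exact div_le_div_of_nonneg_right (by nlinarith [hcol n₂ hn₂ hb, sq_nonneg (β n₂)]) (by norm_num)
  linarith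

/-- **The trivial bound for the pair sum**: `|pairSum| ≤ (2N/(q₀r) + 1) ‖β‖²` (`r, q₁ ≥ 1`,
`N ≥ 0`; every admissible `n₁` lies in a reduced class modulo `q₀r`, which contains at most
`2N/(q₀r) + 1` of the `n₂`). [cite: BombieriFriedlanderIwaniecActa1986, §7 (7.5) p. 223] -/
theorem abs_pairSum_le (a : ℤ) {r q₁ q₂ : ℕ} (hr : 0 < r) (hq₁ : 0 < q₁) {N : ℝ} (hN : 0 ≤ N)
    (β : ℕ → ℝ) :
    |pairSum a r q₁ q₂ N β| ≤ (2 * N / (gmod r q₁ q₂ : ℝ) + 1) * l2Sq N β := by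
  have hG : 0 < gmod r q₁ q₂ := gmod_pos hr hq₁
  have e1 := mul_eq_div_mul_gmod_left r q₁ q₂
  have e2 := mul_eq_div_mul_gmod_right r q₁ q₂
  unfold pairSum
  refine abs_sum_sum_ite_mul_le β _ ?_ ?_
  · intro n₁ _ _
    by_cases hn₁ : n₁.Coprime (q₁ * r)
    · have hu : IsUnit (n₁ : ZMod (gmod r q₁ q₂)) := by
        rw [ZMod.isUnit_iff_coprime]
        rw [e1] at hn₁
        exact Nat.Coprime.coprime_dvd_right (dvd_mul_left _ _) hn₁
      refine le_trans ?_ (card_dyadic_filter_class_le hN hG hu)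
      exact_mod_cast Finset.card_le_card fun n₂ h => by
        rw [Finset.mem_filter] at h ⊢
        exact ⟨h.1, h.2.2.2.2.symm⟩
    · rw [Finset.filter_false_of_mem fun n₂ _ h => hn₁ h.2.1]
      simp only [Finset.card_empty, Nat.cast_zero]
      positivity
  · intro n₂ _ _
    by_cases hn₂ : n₂.Coprime (q₂ * r)
    · have hu : IsUnit (n₂ : ZMod (gmod r q₁ q₂)) := by
        rw [ZMod.isUnit_iff_coprime]
        rw [e2] at hn₂
        exact Nat.Coprime.coprime_dvd_right (dvd_mul_left _ _) hn₂
      refine le_trans ?_ (card_dyadic_filter_class_le hN hG hu)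
      exact_mod_cast Finset.card_le_card fun n₁ h => by
        rw [Finset.mem_filter] at h ⊢
        exact ⟨h.1, h.2.2.2.2⟩
    · rw [Finset.filter_false_of_mem fun n₁ _ h => hn₂ h.2.2.1]
      simp only [Finset.card_empty, Nat.cast_zero]
      positivity

/-- The pair sum of `𝒳` at `(r, q₁, q₂)` restricted to the pairs with a common factor. [folklore] -/
def pairSumN (a : ℤ) (r q₁ q₂ : ℕ) (N : ℝ) (β : ℕ → ℝ) : ℝ :=
  ∑ n₁ ∈ dyadic N, ∑ n₂ ∈ dyadic N,
    if ¬n₁.Coprime n₂ ∧ (IsCoprime ((q₁ * q₂ * r : ℕ) : ℤ) a ∧ n₁.Coprime (q₁ * r) ∧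
      n₂.Coprime (q₂ * r) ∧ (n₁ : ZMod (gmod r q₁ q₂)) = (n₂ : ZMod (gmod r q₁ q₂))) then
      β n₁ * β n₂ else 0

/-- `calX` at `(r, q₁, q₂)` is `[q₀ ≤ Q₀] γγ (pairSum − pairSumN)/L` (`r, q₁, q₂ ≥ 1`). [folklore] -/
theorem calX_term_eq (a : ℤ) {r q₁ q₂ : ℕ} (hr : 0 < r) (hq₁ : 0 < q₁) (hq₂ : 0 < q₂) (N Q₀ : ℝ)
    (β γ : ℕ → ℝ) :
    (open Classical in
    ∑ n₁ ∈ dyadic N, ∑ n₂ ∈ dyadic N, (if Main Q₀ q₁ q₂ n₁ n₂ ∧ Solvable a r q₁ q₂ n₁ n₂ then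
      γ q₁ * γ q₂ * β n₁ * β n₂ / (lmod r q₁ q₂ : ℝ) else 0)) =
      if (Nat.gcd q₁ q₂ : ℝ) ≤ Q₀ then
        γ q₁ * γ q₂ * (pairSum a r q₁ q₂ N β - pairSumN a r q₁ q₂ N β) / (lmod r q₁ q₂ : ℝ)
      else 0 := by
  classical
  by_cases hg : (Nat.gcd q₁ q₂ : ℝ) ≤ Q₀
  · rw [if_pos hg]
    rw [show γ q₁ * γ q₂ * (pairSum a r q₁ q₂ N β - pairSumN a r q₁ q₂ N β) / (lmod r q₁ q₂ : ℝ) =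
      (γ q₁ * γ q₂ / (lmod r q₁ q₂ : ℝ)) * (pairSum a r q₁ q₂ N β - pairSumN a r q₁ q₂ N β) by ring]
    unfold pairSum pairSumN
    rw [← Finset.sum_sub_distrib, Finset.mul_sum]
    refine Finset.sum_congr rfl fun n₁ _ => ?_
    rw [← Finset.sum_sub_distrib, Finset.mul_sum]
    refine Finset.sum_congr rfl fun n₂ _ => ?_
    rw [solvable_iff hr hq₁ hq₂]
    by_cases hc : n₁.Coprime n₂ <;>
      by_cases hs : IsCoprime ((q₁ * q₂ * r : ℕ) : ℤ) a ∧ n₁.Coprime (q₁ * r) ∧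
        n₂.Coprime (q₂ * r) ∧ (n₁ : ZMod (gmod r q₁ q₂)) = (n₂ : ZMod (gmod r q₁ q₂))
    · rw [if_pos ⟨⟨hc, hg⟩, hs⟩, if_pos hs, if_neg (fun h => h.1 hc)]; ring
    · rw [if_neg (fun h => hs h.2), if_neg hs, if_neg (fun h => hs h.2)]; ring
    · rw [if_neg (fun h => hc h.1.1), if_pos hs, if_pos ⟨hc, hs⟩]; ring
    · rw [if_neg (fun h => hc h.1.1), if_neg hs, if_neg (fun h => hs h.2)]; ring
  · rw [if_neg hg]
    refine Finset.sum_eq_zero fun n₁ _ => Finset.sum_eq_zero fun n₂ _ => ?_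
    rw [if_neg (fun h => hg h.1.2)]

/-- **Pairs with a common factor are rare** (BFI p. 222: "We remove from `𝒳` … the condition
`(n₁, n₂) = 1` at the cost of the admissible error term (7.1). The arguments are the same as those
for (6.4)"), here by the trivial count using (A₄): if `β` vanishes at the `n ∼ N` with a prime
factor `≤ z` (`z ≥ 1`), then
`|pairSumN| ≤ log₂(2N) · (2N/(z q₀ r) + 1) · ‖β‖²`
(a pair with `β_{n₁}β_{n₂} ≠ 0` and `(n₁,n₂) > 1` shares a prime `p > z`, at most `ω(n₁) ≤ log₂(2N)`
choices, and the `n₂ ≡ n₁ (q₀r)` divisible by `p` number `≤ 2N/(p q₀ r) + 1`).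
[cite: BombieriFriedlanderIwaniecActa1986, §7 (7.1) p. 222] -/
theorem abs_pairSumN_le (a : ℤ) {r q₁ q₂ : ℕ} (hr : 0 < r) (hq₁ : 0 < q₁) {N : ℝ} (hN : 0 ≤ N)
    {z : ℝ} (hz : 1 ≤ z) {β : ℕ → ℝ} (hβ : IsSifted (dyadic N) z β) :
    |pairSumN a r q₁ q₂ N β| ≤
      ((Nat.log 2 ⌊2 * N⌋₊ : ℝ) * (2 * N / (z * (gmod r q₁ q₂ : ℝ)) + 1)) * l2Sq N β := by
  have hG : 0 < gmod r q₁ q₂ := gmod_pos hr hq₁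
  set G := gmod r q₁ q₂ with hGdef
  haveI : NeZero G := ⟨hG.ne'⟩
  have e1 := mul_eq_div_mul_gmod_left r q₁ q₂
  have e2 := mul_eq_div_mul_gmod_right r q₁ q₂
  rw [← hGdef] at e1 e2
  have hK0 : 0 ≤ (Nat.log 2 ⌊2 * N⌋₊ : ℝ) * (2 * N / (z * (G : ℝ)) + 1) := by positivity
  -- the count, for a rough `n` coprime to `G`
  have hcount : ∀ n ∈ dyadic N, β n ≠ 0 → n.Coprime G →
      (#((dyadic N).filter (fun m => ¬n.Coprime m ∧ (m : ZMod G) = (n : ZMod G))) : ℝ) ≤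
        (Nat.log 2 ⌊2 * N⌋₊ : ℝ) * (2 * N / (z * (G : ℝ)) + 1) := by
    intro n hn hβn hnG
    have hn0 : 0 < n := pos_of_mem_dyadic hN hn
    -- `n` is `z`-rough
    have hrough : ∀ p ∈ n.primeFactors, z < (p : ℝ) := by
      intro p hp
      by_contra hle
      exact hβn (hβ n hn ⟨p, Nat.prime_of_mem_primeFactors hp, Nat.dvd_of_mem_primeFactors hp,
        not_lt.1 hle⟩)
    -- cover by the prime factors
    have hcov : (dyadic N).filter (fun m => ¬n.Coprime m ∧ (m : ZMod G) = (n : ZMod G)) ⊆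
        n.primeFactors.biUnion (fun p => (dyadic N).filter
          (fun m : ℕ => (m : ZMod G) = (n : ZMod G) ∧ p ∣ m)) := by
      intro m hm
      rw [Finset.mem_filter] at hm
      obtain ⟨hmN, hcop, hmc⟩ := hm
      rw [Finset.mem_biUnion]
      obtain ⟨p, hp, hpn, hpm⟩ := Nat.Prime.not_coprime_iff_dvd.1 hcop
      exact ⟨p, Nat.mem_primeFactors.2 ⟨hp, hpn, hn0.ne'⟩, Finset.mem_filter.2 ⟨hmN, hmc, hpm⟩⟩
    have hcard := Finset.card_le_card hcov
    have hcard2 := (hcard.trans Finset.card_biUnion_le)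
    refine le_trans (show (#((dyadic N).filter (fun m => ¬n.Coprime m ∧ (m : ZMod G) = (n : ZMod G))) : ℝ) ≤
      ∑ p ∈ n.primeFactors, (#((dyadic N).filter (fun m : ℕ => (m : ZMod G) = (n : ZMod G) ∧ p ∣ m)) : ℝ)
      by exact_mod_cast hcard2) ?_
    have hterm : ∀ p ∈ n.primeFactors,
        (#((dyadic N).filter (fun m : ℕ => (m : ZMod G) = (n : ZMod G) ∧ p ∣ m)) : ℝ) ≤
          2 * N / (z * (G : ℝ)) + 1 := by
      intro p hp
      have hpp := Nat.prime_of_mem_primeFactors hp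
      have hpG : p.Coprime G := Nat.Coprime.coprime_dvd_left (Nat.dvd_of_mem_primeFactors hp) hnG
      have h1 : (dyadic N).filter (fun m : ℕ => (m : ZMod G) = (n : ZMod G) ∧ p ∣ m) ⊆
          (Finset.Icc 1 ⌊2 * N⌋₊).filter (fun m : ℕ => (m : ZMod G) = (n : ZMod G) ∧ p ∣ m) :=
        Finset.filter_subset_filter _ (dyadic_subset_Icc hN)
      have h2 := BFILemma3.card_filter_dvd_le ⌊2 * N⌋₊ hpp.pos hG (n : ZMod G)
      rw [Nat.Coprime.lcm_eq_mul hpG] at h2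
      have hzp : z ≤ p := (hrough p hp).le
      have hL : (⌊2 * N⌋₊ : ℝ) ≤ 2 * N := Nat.floor_le (by linarith)
      calc (#((dyadic N).filter (fun m : ℕ => (m : ZMod G) = (n : ZMod G) ∧ p ∣ m)) : ℝ)
          ≤ #((Finset.Icc 1 ⌊2 * N⌋₊).filter (fun m : ℕ => (m : ZMod G) = (n : ZMod G) ∧ p ∣ m)) := by
            exact_mod_cast Finset.card_le_card h1
        _ ≤ ((⌊2 * N⌋₊ / (p * G) + 1 : ℕ) : ℝ) := by exact_mod_cast h2
        _ = ((⌊2 * N⌋₊ / (p * G) : ℕ) : ℝ) + 1 := by push_cast; ring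
        _ ≤ (⌊2 * N⌋₊ : ℝ) / ((p * G : ℕ) : ℝ) + 1 := by gcongr; exact Nat.cast_div_le
        _ = (⌊2 * N⌋₊ : ℝ) / ((p : ℝ) * G) + 1 := by push_cast; ring
        _ ≤ 2 * N / (z * (G : ℝ)) + 1 := by gcongr
    refine (Finset.sum_le_sum hterm).trans ?_
    rw [Finset.sum_const, nsmul_eq_mul]
    refine mul_le_mul_of_nonneg_right ?_ (by positivity)
    have hω := card_primeFactors_le_log n
    have hnle : n ≤ ⌊2 * N⌋₊ := by
      have := ((mem_dyadic hN).1 hn).2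
      exact Nat.le_floor this
    exact_mod_cast hω.trans (Nat.log_mono_right hnle)
  unfold pairSumN
  refine abs_sum_sum_ite_mul_le β _ ?_ ?_
  · intro n₁ hn₁ hb
    by_cases hc : n₁.Coprime (q₁ * r)
    · have hn₁G : n₁.Coprime G := by
        rw [e1] at hc; exact Nat.Coprime.coprime_dvd_right (dvd_mul_left _ _) hc
      refine le_trans ?_ (hcount n₁ hn₁ hb hn₁G)
      exact_mod_cast Finset.card_le_card fun n₂ h => by
        rw [Finset.mem_filter] at h ⊢
        exact ⟨h.1, h.2.1, h.2.2.2.2.2.symm⟩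
    · rw [Finset.filter_false_of_mem fun n₂ _ h => hc h.2.2.1]
      simp only [Finset.card_empty, Nat.cast_zero]
      exact hK0
  · intro n₂ hn₂ hb
    by_cases hc : n₂.Coprime (q₂ * r)
    · have hn₂G : n₂.Coprime G := by
        rw [e2] at hc; exact Nat.Coprime.coprime_dvd_right (dvd_mul_left _ _) hc
      refine le_trans ?_ (hcount n₂ hn₂ hb hn₂G)
      exact_mod_cast Finset.card_le_card fun n₁ h => by
        rw [Finset.mem_filter] at h ⊢
        exact ⟨h.1, fun h' => h.2.1 (Nat.Coprime.symm h'), h.2.2.2.2.2⟩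
    · rw [Finset.filter_false_of_mem fun n₁ _ h => hc h.2.2.2.1]
      simp only [Finset.card_empty, Nat.cast_zero]
      exact hK0


/-! ### `𝒳` versus `X` -/

/-- The bound of one index of `𝒳 − X`: for `q₀ ≤ Q₀` the Barban–Davenport–Halberstam cross term
plus the pairs with a common factor, for `q₀ > Q₀` the trivial bound for the `X`-term. [folklore] -/
def xErr (N Q₀ z : ℝ) (β γ : ℕ → ℝ) (r q₁ q₂ : ℕ) : ℝ :=
  if (Nat.gcd q₁ q₂ : ℝ) ≤ Q₀ then
    |γ q₁| * |γ q₂| / (lmod r q₁ q₂ : ℝ) *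
        ((bdhD N β (q₁ / Nat.gcd q₁ q₂) (gmod r q₁ q₂) +
          bdhD N β (q₂ / Nat.gcd q₁ q₂) (gmod r q₁ q₂)) / 2) +
      |γ q₁| * |γ q₂| / (lmod r q₁ q₂ : ℝ) *
        (((Nat.log 2 ⌊2 * N⌋₊ : ℝ) * (2 * N / (z * (gmod r q₁ q₂ : ℝ)) + 1)) * l2Sq N β)
  else
    |γ q₁| * |γ q₂| * (∑ n ∈ dyadic N, |β n|) ^ 2 /
      ((lmod r q₁ q₂ : ℝ) * (Nat.totient (gmod r q₁ q₂) : ℝ))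

/-- **`𝒳 = X + O(…)`** (BFI §7, (7.1)–(7.5), pp. 222–223: "`𝒳` is asymptotically equal to `X`,
apart from the admissible error term `O(‖β‖²NR⁻¹ℒ^{−A})` (7.1). This result is essentially of the
type of the Barban–Davenport–Halberstam theorem and rests on Theorem 0 … (7.5) Finally, extending
the summation over all `q₀` we get `𝒳₀ = X + O(…)`"), in explicit form: for `N, Q, R ≥ 0`, `z ≥ 1`
and `β` vanishing at the `n ∼ N` with a prime factor `≤ z` ((A₄)),
`|𝒳 − X| ≤ ∑_{r∼R} ∑_{q₁,q₂∼Q} xErr`, where `xErr` is, for `q₀ ≤ Q₀`, the cross term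
`|γγ|/L · (D(q₁';q₀r) + D(q₂';q₀r))/2` of the Barban–Davenport–Halberstam deviations `D = BFI.bdhD`
(to be bounded by Theorem 0 (a) = `BombieriFriedlanderIwaniecTheorem0a` summed over `r`) plus
`|γγ|/L · log₂(2N)(2N/(z q₀ r)+1)‖β‖²` for the pairs with a common factor ((7.1)), and for
`q₀ > Q₀` (where `𝒳` has no terms) the trivial bound `|γγ|(∑|β|)²/(Lφ(q₀r))` for the `X`-term
((7.5)).  The main terms match EXACTLY by `φ(q₁q₂r)φ(q₀r) = q₀φ(q₁r)φ(q₂r)` (`BFI.mainX_term_eq`).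
[cite: BombieriFriedlanderIwaniecActa1986, §7 (7.1)–(7.5) pp. 222–223] -/
theorem abs_calX_sub_mainX_le (a : ℤ) {N Q R : ℝ} (hN : 0 ≤ N) (hQ : 0 ≤ Q) (hR : 0 ≤ R)
    (Q₀ : ℝ) (β γ : ℕ → ℝ) {z : ℝ} (hz : 1 ≤ z) (hβ : IsSifted (dyadic N) z β) :
    |calX a N Q R Q₀ β γ - mainX a N Q R β γ| ≤
      ∑ r ∈ dyadic R, ∑ q₁ ∈ dyadic Q, ∑ q₂ ∈ dyadic Q, xErr N Q₀ z β γ r q₁ q₂ := by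
  classical
  unfold calX mainX
  rw [← Finset.sum_sub_distrib]
  refine (Finset.abs_sum_le_sum_abs _ _).trans (Finset.sum_le_sum fun r hr => ?_)
  rw [← Finset.sum_sub_distrib]
  refine (Finset.abs_sum_le_sum_abs _ _).trans (Finset.sum_le_sum fun q₁ hq₁ => ?_)
  rw [← Finset.sum_sub_distrib]
  refine (Finset.abs_sum_le_sum_abs _ _).trans (Finset.sum_le_sum fun q₂ hq₂ => ?_)
  have hr0 := pos_of_mem_dyadic hR hr
  have hq₁0 := pos_of_mem_dyadic hQ hq₁
  have hq₂0 := pos_of_mem_dyadic hQ hq₂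
  have hL : (0 : ℝ) < (lmod r q₁ q₂ : ℝ) := by exact_mod_cast lmod_pos hr0 hq₁0 hq₂0
  have hG : 0 < gmod r q₁ q₂ := gmod_pos hr0 hq₁0
  have hφG : (0 : ℝ) < (Nat.totient (gmod r q₁ q₂) : ℝ) := by exact_mod_cast Nat.totient_pos.2 hG
  rw [calX_term_eq a hr0 hq₁0 hq₂0 N Q₀ β γ]
  unfold xErr
  by_cases hg : (Nat.gcd q₁ q₂ : ℝ) ≤ Q₀
  · rw [if_pos hg, if_pos hg]
    have hN' := abs_pairSumN_le a hr0 hq₁0 hN hz hβ (q₂ := q₂)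
    have hsplit : γ q₁ * γ q₂ * (pairSum a r q₁ q₂ N β - pairSumN a r q₁ q₂ N β) /
        (lmod r q₁ q₂ : ℝ) = γ q₁ * γ q₂ * pairSum a r q₁ q₂ N β / (lmod r q₁ q₂ : ℝ) -
          γ q₁ * γ q₂ / (lmod r q₁ q₂ : ℝ) * pairSumN a r q₁ q₂ N β := by ring
    rw [hsplit]
    refine (abs_sub_le _ (γ q₁ * γ q₂ * pairSum a r q₁ q₂ N β / (lmod r q₁ q₂ : ℝ)) _).trans ?_
    rw [sub_sub_cancel_left, abs_neg, add_comm]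
    refine add_le_add (abs_pairSum_sub_mainX_term_le a hr0 hq₁0 hq₂0 N β γ) ?_
    rw [abs_mul, abs_div, abs_mul, abs_of_pos hL]
    exact mul_le_mul_of_nonneg_left hN' (by positivity)
  · rw [if_neg hg, if_neg hg, zero_sub, abs_neg, mainX_term_eq a hr0 hq₁0 hq₂0]
    split_ifs with hka
    · rw [abs_div, abs_mul, abs_mul, abs_mul, abs_mul, abs_of_pos hL, abs_of_pos hφG]
      have h1 := abs_cSum_le N β ((q₁ / Nat.gcd q₁ q₂) * gmod r q₁ q₂)
      have h2 := abs_cSum_le N β ((q₂ / Nat.gcd q₁ q₂) * gmod r q₁ q₂)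
      have hS := Finset.sum_nonneg (fun n (_ : n ∈ dyadic N) => abs_nonneg (β n))
      rw [sq]
      gcongr
    · rw [abs_zero]; positivity

end BFI

end Literature.NumberTheory.Sieve
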